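import Mathlib
import HarnessLib
import Summits.Ventures.LatticeQCDFlow.Exactness.SUNExpDriftWork

/-!
# `SU(N)` rung in general coordinates — THE ENERGY ERROR OF THE ENGINE'S `n`-STEP LEAPFROG PROPOSAL `sunLeapfrogProposalN ι hι ε g n` WITH THE CONSISTENT HALF KICK IS SECOND ORDER, WITH EXPLICIT CONSTANTS: `|ΔH| ≤ n·βK·N²C_ι|ε|·(‖p‖ + (2n+1)D_max/(4κ))·(Σ_l‖p_l‖ + (2n+1)|L|D_max/(4κ) + |L|D_max/(8κ))` for ANY action whose represented force field is bounded by `D_max` and `K`-Lipschitz in the matrix sup norm — the «acceptance vs step size» law of the row on the `SU(N)` rung (`SU(3)` included), typed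

HONEST FRAMING: exact (Metropolis-corrected) sampling algorithms for lattice gauge theory;
figures of merit are autocorrelation/cost numbers at stated couplings and volumes; no
continuum-physics claim.

Venture `LatticeQCDFlow` (cell pub-lqcd), topic `Exactness`; FANOUT row 14 (`eng-flowhmc`, engine
`latflow.fthmc`, family B; the row's test columns «acceptance vs step size», `⟨e^{−ΔH}⟩ = 1`) — the `SU(N)` rung
of rows 21–26.  The general-coordinates twin of `SU2LeapfrogEnergyError` / `U1LeapfrogEnergyError`.  NEW WORK of
the cell over the tree: `SUNExpDriftWork` (§1 the drift moves a configuration by `≤ N²C_ι|ε|‖p‖` in the matrix sup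
norm; §2 the work identity and the first-order Taylor bound `½N²C_ιβ|ε|K‖p‖Σ‖p_l‖` for any action and any force
field represented through a bounded pairing `B`), row 9's kernel of record `SUNMultiStepLeapfrogHMC`
(`sunExpDrift`, the `n`-step proposal `sunLeapfrogProposalN ι hι ε g n = flip ∘ (palindromicWord [kick g] (drift (mulDrift (sunExpDrift ι hι ε))))ⁿ`
— the proposal inside `sunLeapfrogHMCN`, hence inside the engine kernels of `SUNMultiStepLeapfrogHMCEngine` /
`SUNMultiStepLeapfrogFTHMCEngine` and, in Pauli coordinates, `su2LeapfrogHMCN`), `SplittingIntegrator` /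
`SplittingWords` (`kick`, `drift`, `mulDrift`, `flip`, `palindromicWord`); nothing is cited as a fact; no number.
SETTING: ANY linear coordinates `ι : E →ₗ[ℝ] M_N(ℂ)` of `𝔰𝔲(N)` with `‖ι x‖_{∞-op} ≤ C_ι‖x‖`; ANY action
`S : (L → SU(N)) → ℝ`; a kinetic term `κΣ_l B(p_l, p_l)` for ANY symmetric pairing `B` with `|B(x,y)| ≤ β‖x‖‖y‖`
(`B = ⟪·,·⟫`, `β = 1` recovers `su2Kinetic κ`; the polarisation of `−tr P²` the engine's `sunKinetic`); a force field
`D` REPRESENTING the differential of `a ↦ S(e_ε(a)·W)` at `0` through `B` (`= Σ_l B(D(W)_l, δ_l)`), bounded by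
`D_max` linkwise and `K`-Lipschitz in the matrix sup norm `‖coeConfig W − coeConfig W'‖`; and the CONSISTENT half kick
`g = −D/(4κ)` — the one for which kick–drift–kick is the leapfrog discretisation of `H = S + κΣB(p_l,p_l)` in the time
unit of the drift.  For the members `D^ε S̃ = (ε/κ)Φ_κ`, so `D_max`, `K` are `O(ε)` and every bound below is `O(nε²)`.

* §3 **`sunLeapfrogStep_apply`** — the engine's step, read off: `(q, p) ↦ (e_ε(p₁)·q, p₁ + g(e_ε(p₁)·q))`,
  `p₁ = p + g(q)`; `pairing_sq_sub_sq` (`B(y,y) − B(x,x) = B(y − x, y + x)` for symmetric `B`);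
  **`sunLeapfrog_energy_identity`** — `H(q',p') − H(q,p) = ½Σ_l B(p₁,l, D(q)_l − D(q')_l) +
  [S(q') − S(q) − Σ_l B(D(q)_l, p₁,l)] + κΣ_l(B(g(q')_l, g(q')_l) − B(g(q)_l, g(q)_l))` EXACTLY (the first-order
  terms cancel); `norm_sunHalfKick_apply_le` (`‖g(W)_l‖ ≤ D_max/(4κ)`); **`abs_sunLeapfrog_energy_error_le`** —
  `|H(q',p') − H(q,p)| ≤ βK·N²C_ι|ε|‖p₁‖·(Σ_l‖p₁,l‖ + |L|·D_max/(8κ))`: SECOND ORDER in the step size, linear in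
  the number of links, every constant explicit (`N = 2`, `C_ι = 2`, `β = 1`: the `SU(2)` file's `8K|ε|‖p₁‖(Σ + |L|D_max/(8κ))`);
* §4 `norm_sunHalfKick_le`, `sunLeapfrogStep_iterate_snd_le` (momentum growth: after `k` steps
  `‖p_k‖ ≤ ‖p‖ + 2k·D_max/(4κ)`, `Σ‖p_k,l‖ ≤ Σ‖p_l‖ + 2k|L|·D_max/(4κ)`), **`abs_sunLeapfrogN_energy_error_le`**
  (the `n`-step trajectory, `k ≤ N` steps: `≤ k·B_N`) and **`abs_sunLeapfrogProposalN_energy_error_le`** — THE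
  ENERGY ERROR OF THE ENGINE'S PROPOSAL `sunLeapfrogProposalN ι hι ε g n`, i.e. the quantity in the Metropolis test
  of `sunLeapfrogHMCN`: `≤ n·βK·N²C_ι|ε|·(‖p‖ + (2n+1)D_max/(4κ))·(Σ_l‖p_l‖ + (2n+1)|L|D_max/(4κ) + |L|D_max/(8κ))`
  — `O(nε²) = O(τε)` at fixed trajectory length `τ = nε`; the acceptance probability is `≥ exp(−that)` pointwise.

NOT CLAIMED: the mean acceptance under the Gibbs law; optimal constants; the dictionary identifying the engine's
autodiff output in its coordinates `sunCoordι` with a `B`-represented `D` (row 9's `SUNKickCoordinates`); OMF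
words; floating point; any number.
-/

noncomputable section

namespace Summit.Ventures.LatticeQCDFlow.Exactness

open Set Function NormedSpace
open scoped Matrix Matrix.Norms.Operator

set_option backward.isDefEq.respectTransparency false

variable {n : Type*} [Fintype n] [DecidableEq n]
variable {E : Type*} [NormedAddCommGroup E] [NormedSpace ℝ E]
variable (ι : E →ₗ[ℝ] Matrix n n ℂ) (hι : ∀ a, (ι a)ᴴ = -ι a ∧ (ι a).trace = 0)
variable {L : Type*}

/-! ## §3 One leapfrog step of the `SU(N)` kernel: the step read off, the energy identity for the consistent half kick, the second-order bound -/

section Step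

/-- **The engine's step `palindromicWord [kick g] (drift (mulDrift (sunExpDrift ι hι ε)))` is kick–drift–kick**:
`(q, p) ↦ (e_ε(p₁)·q, p₁ + g(e_ε(p₁)·q))` with `p₁ = p + g(q)`. -/
theorem sunLeapfrogStep_apply (g : (L → Matrix.specialUnitaryGroup n ℂ) → L → E) (ε : ℝ)
    (q : L → Matrix.specialUnitaryGroup n ℂ) (p : L → E) :
    palindromicWord [kick g] (drift (mulDrift (sunExpDrift ι hι ε))) (q, p) =
      (sunExpDrift ι hι ε (p + g q) * q, (p + g q) + g (sunExpDrift ι hι ε (p + g q) * q)) := by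
  simp only [palindromicWord, List.prod_cons, List.prod_nil, mul_one, List.reverse_singleton,
    Equiv.Perm.mul_apply]
  rfl

variable (B : E →ₗ[ℝ] E →ₗ[ℝ] ℝ)

omit [Fintype n] [DecidableEq n] in
/-- For a symmetric pairing, `B(y,y) − B(x,x) = B(y − x, y + x)`. -/
theorem pairing_sq_sub_sq (hBs : ∀ x y : E, B x y = B y x) (x y : E) : B y y - B x x = B (y - x) (y + x) := by
  rw [LinearMap.map_sub₂, map_add, map_add, hBs x y]
  ring

variable [Fintype L]

/-- **THE ENERGY IDENTITY FOR THE CONSISTENT HALF KICK `g = −D/(4κ)`** (`H = S + κΣ_l B(p_l,p_l)`, `B` symmetric):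
with `p₁ = p + g(q)`, `q' = e_ε(p₁)·q`, `p' = p₁ + g(q')`,
`H(q',p') − H(q,p) = ½Σ_l B(p₁,l, D(q)_l − D(q')_l) + [S(q') − S(q) − Σ_l B(D(q)_l, p₁,l)] + κΣ_l (B(g(q')_l,g(q')_l) − B(g(q)_l,g(q)_l))`
— the first-order terms cancel exactly. -/
theorem sunLeapfrog_energy_identity (S : (L → Matrix.specialUnitaryGroup n ℂ) → ℝ) (ε κ : ℝ) (hκ : κ ≠ 0)
    (hBs : ∀ x y : E, B x y = B y x) (D g : (L → Matrix.specialUnitaryGroup n ℂ) → L → E)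
    (hg : ∀ W l, g W l = -(1 / (4 * κ)) • D W l)
    (q : L → Matrix.specialUnitaryGroup n ℂ) (p : L → E) :
    (S (sunExpDrift ι hι ε (p + g q) * q) +
        κ * ∑ l, B (((p + g q) + g (sunExpDrift ι hι ε (p + g q) * q)) l) (((p + g q) + g (sunExpDrift ι hι ε (p + g q) * q)) l)) -
      (S q + κ * ∑ l, B (p l) (p l)) =
      (1 / 2) * ∑ l, B ((p + g q) l) (D q l - D (sunExpDrift ι hι ε (p + g q) * q) l) +
        (S (sunExpDrift ι hι ε (p + g q) * q) - S q - ∑ l, B (D q l) ((p + g q) l)) +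
        κ * ∑ l, (B (g (sunExpDrift ι hι ε (p + g q) * q) l) (g (sunExpDrift ι hι ε (p + g q) * q) l) - B (g q l) (g q l)) := by
  set p₁ := p + g q with hp₁
  set q' := sunExpDrift ι hι ε p₁ * q with hq'
  have hp : p = p₁ - g q := by rw [hp₁, add_sub_cancel_right]
  rw [hp]
  have key : ∀ l, κ * (B (p₁ l + g q' l) (p₁ l + g q' l) - B ((p₁ - g q) l) ((p₁ - g q) l)) =
      (1 / 2) * B (p₁ l) (D q l - D q' l) - B (D q l) (p₁ l) + κ * (B (g q' l) (g q' l) - B (g q l) (g q l)) := by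
    intro l
    rw [Pi.sub_apply, hg q l, hg q' l]
    simp only [map_add, map_sub, map_smul, LinearMap.add_apply, LinearMap.sub_apply, LinearMap.smul_apply, smul_eq_mul]
    rw [hBs (D q l) (p₁ l), hBs (D q' l) (p₁ l)]
    field_simp
    ring
  have hsum : κ * ∑ l, (B (p₁ l + g q' l) (p₁ l + g q' l) - B ((p₁ - g q) l) ((p₁ - g q) l)) =
      (1 / 2) * ∑ l, B (p₁ l) (D q l - D q' l) - ∑ l, B (D q l) (p₁ l) + κ * ∑ l, (B (g q' l) (g q' l) - B (g q l) (g q l)) := by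
    rw [Finset.mul_sum, Finset.mul_sum, Finset.mul_sum, ← Finset.sum_sub_distrib, ← Finset.sum_add_distrib]
    exact Finset.sum_congr rfl fun l _ => key l
  have hsplit : κ * ∑ l, B ((p₁ + g q') l) ((p₁ + g q') l) - κ * ∑ l, B ((p₁ - g q) l) ((p₁ - g q) l) =
      κ * ∑ l, (B (p₁ l + g q' l) (p₁ l + g q' l) - B ((p₁ - g q) l) ((p₁ - g q) l)) := by
    rw [Finset.sum_sub_distrib, mul_sub]
    rfl
  linarith [hsum, hsplit]

omit [Fintype L] in
/-- The consistent half kick is bounded by `D_max/(4κ)` linkwise. -/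
theorem norm_sunHalfKick_apply_le (κ : ℝ) (hκ : 0 < κ) (D g : (L → Matrix.specialUnitaryGroup n ℂ) → L → E)
    (hg : ∀ W l, g W l = -(1 / (4 * κ)) • D W l) {Dmax : ℝ}
    (hDb : ∀ (W : L → Matrix.specialUnitaryGroup n ℂ) (l : L), ‖D W l‖ ≤ Dmax)
    (W : L → Matrix.specialUnitaryGroup n ℂ) (l : L) : ‖g W l‖ ≤ Dmax / (4 * κ) := by
  have hq : (0 : ℝ) < 1 / (4 * κ) := by positivity
  rw [hg W l, norm_smul, norm_neg, Real.norm_eq_abs, abs_of_pos hq]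
  calc 1 / (4 * κ) * ‖D W l‖ ≤ 1 / (4 * κ) * Dmax := by gcongr; exact hDb W l
    _ = Dmax / (4 * κ) := by ring

/-- **THE ENERGY ERROR OF ONE LEAPFROG STEP OF THE `SU(N)` KERNEL IS SECOND ORDER, EXPLICITLY**: if
`a ↦ S(e_ε(a)·W)` is differentiable at `0` for every `W` with differential `Σ_l B(D(W)_l, ·_l)`, `B` symmetric with
`|B(x,y)| ≤ β‖x‖‖y‖`, `‖D(W)_l‖ ≤ D_max`, `D` `K`-Lipschitz in the matrix sup norm and `‖ι x‖ ≤ C_ι‖x‖`, then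
for the consistent half kick `g = −D/(4κ)` (`κ > 0`), with `p₁ = p + g(q)`:
`|H(q',p') − H(q,p)| ≤ βK·N²C_ι|ε|‖p₁‖·(Σ_l‖p₁,l‖ + |L|·D_max/(8κ))`. -/
theorem abs_sunLeapfrog_energy_error_le {Cι : ℝ} (hC0 : 0 ≤ Cι) (hCι : ∀ x : E, ‖ι x‖ ≤ Cι * ‖x‖)
    (S : (L → Matrix.specialUnitaryGroup n ℂ) → ℝ) (ε κ : ℝ) (hκ : 0 < κ)
    (hd : ∀ W : L → Matrix.specialUnitaryGroup n ℂ, DifferentiableAt ℝ (fun a : L → E => S (sunExpDrift ι hι ε a * W)) 0)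
    (hBs : ∀ x y : E, B x y = B y x) {β : ℝ} (hβ0 : 0 ≤ β) (hBβ : ∀ x y : E, |B x y| ≤ β * ‖x‖ * ‖y‖)
    (D g : (L → Matrix.specialUnitaryGroup n ℂ) → L → E)
    (hD : ∀ (W : L → Matrix.specialUnitaryGroup n ℂ) (δ : L → E),
      fderiv ℝ (fun a : L → E => S (sunExpDrift ι hι ε a * W)) 0 δ = ∑ l, B (D W l) (δ l))
    {Dmax K : ℝ} (hK0 : 0 ≤ K)
    (hDb : ∀ (W : L → Matrix.specialUnitaryGroup n ℂ) (l : L), ‖D W l‖ ≤ Dmax)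
    (hDK : ∀ W W' : L → Matrix.specialUnitaryGroup n ℂ, ‖D W - D W'‖ ≤ K * ‖coeConfig W - coeConfig W'‖)
    (hg : ∀ W l, g W l = -(1 / (4 * κ)) • D W l)
    (q : L → Matrix.specialUnitaryGroup n ℂ) (p : L → E) :
    |(S (sunExpDrift ι hι ε (p + g q) * q) +
        κ * ∑ l, B (((p + g q) + g (sunExpDrift ι hι ε (p + g q) * q)) l) (((p + g q) + g (sunExpDrift ι hι ε (p + g q) * q)) l)) -
      (S q + κ * ∑ l, B (p l) (p l))| ≤
      β * K * ((Fintype.card n : ℝ) ^ 2 * Cι * |ε| * ‖p + g q‖) *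
        (∑ l, ‖(p + g q) l‖ + Fintype.card L * Dmax / (8 * κ)) := by
  rw [sunLeapfrog_energy_identity ι hι B S ε κ hκ.ne' hBs D g hg q p]
  set p₁ := p + g q with hp₁
  set q' := sunExpDrift ι hι ε p₁ * q with hq'
  set cd : ℝ := (Fintype.card n : ℝ) ^ 2 * Cι * |ε| * ‖p₁‖ with hcd
  have hcd0 : 0 ≤ cd := by rw [hcd]; positivity
  -- the drift moves the field by at most `cd` in the matrix sup norm
  have hdist : ‖coeConfig q - coeConfig q'‖ ≤ cd := by
    have h := norm_coeConfig_sunExpDrift_sub_le ι hι hC0 hCι ε q p₁ 0 1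
    rw [zero_smul, sunExpDrift_zero, one_mul, one_smul, zero_sub, abs_neg, abs_one, mul_one] at h
    rw [hcd]
    exact h
  have hDl : ∀ l, ‖D q l - D q' l‖ ≤ K * cd := fun l =>
    ((norm_le_pi_norm (D q - D q') l).trans (hDK q q')).trans (mul_le_mul_of_nonneg_left hdist hK0)
  -- term 1: ½ Σ B(p₁, D q − D q')
  have h1 : |(1 / 2) * ∑ l, B (p₁ l) (D q l - D q' l)| ≤ (1 / 2) * (β * K * cd * ∑ l, ‖p₁ l‖) := by
    rw [abs_mul, abs_of_pos (by norm_num : (0 : ℝ) < 1 / 2)]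
    refine mul_le_mul_of_nonneg_left ?_ (by norm_num)
    refine (Finset.abs_sum_le_sum_abs _ _).trans ?_
    rw [Finset.mul_sum]
    refine Finset.sum_le_sum fun l _ => ?_
    calc |B (p₁ l) (D q l - D q' l)| ≤ β * ‖p₁ l‖ * ‖D q l - D q' l‖ := hBβ _ _
      _ ≤ β * ‖p₁ l‖ * (K * cd) := mul_le_mul_of_nonneg_left (hDl l) (by positivity)
      _ = β * K * cd * ‖p₁ l‖ := by ring
  -- term 2: the Taylor remainder of the potential (`SUNExpDriftWork` §2)
  have h2 : |S q' - S q - ∑ l, B (D q l) (p₁ l)| ≤ (Fintype.card n : ℝ) ^ 2 * Cι * β * |ε| * K * ‖p₁‖ * (∑ l, ‖p₁ l‖) / 2 :=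
    abs_action_sunExpDrift_sub_linear_le ι hι B hC0 hCι S ε hd D hD hβ0 hBβ hK0 hDK q p₁
  have h2' : (Fintype.card n : ℝ) ^ 2 * Cι * β * |ε| * K * ‖p₁‖ * (∑ l, ‖p₁ l‖) / 2 = (1 / 2) * (β * K * cd * ∑ l, ‖p₁ l‖) := by
    rw [hcd]; ring
  -- term 3: κ Σ (B(g q', g q') − B(g q, g q))
  have h3 : |κ * ∑ l, (B (g q' l) (g q' l) - B (g q l) (g q l))| ≤ Fintype.card L * (β * K * cd * Dmax / (8 * κ)) := by
    rw [abs_mul, abs_of_pos hκ]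
    have hq4 : (0 : ℝ) < 1 / (4 * κ) := by positivity
    have hgb : ∀ W l, ‖g W l‖ ≤ Dmax / (4 * κ) := fun W l => norm_sunHalfKick_apply_le κ hκ D g hg hDb W l
    have hge : ∀ l, |B (g q' l) (g q' l) - B (g q l) (g q l)| ≤ β * K * cd * Dmax / (8 * κ ^ 2) := by
      intro l
      rw [pairing_sq_sub_sq B hBs (g q l) (g q' l)]
      have hsum : ‖g q' l + g q l‖ ≤ 2 * Dmax / (4 * κ) := by
        calc ‖g q' l + g q l‖ ≤ ‖g q' l‖ + ‖g q l‖ := norm_add_le _ _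
          _ ≤ Dmax / (4 * κ) + Dmax / (4 * κ) := add_le_add (hgb _ l) (hgb _ l)
          _ = 2 * Dmax / (4 * κ) := by ring
      have hdiff : ‖g q' l - g q l‖ ≤ K * cd / (4 * κ) := by
        rw [hg, hg, ← smul_sub, norm_smul, norm_neg, Real.norm_eq_abs, abs_of_pos hq4, norm_sub_rev]
        calc 1 / (4 * κ) * ‖D q l - D q' l‖ ≤ 1 / (4 * κ) * (K * cd) := by gcongr; exact hDl l
          _ = K * cd / (4 * κ) := by ring
      have L1 : (K * cd / (4 * κ)) * (2 * Dmax / (4 * κ)) = K * cd * Dmax / (8 * κ ^ 2) := by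
        field_simp; ring
      calc |B (g q' l - g q l) (g q' l + g q l)| ≤ β * ‖g q' l - g q l‖ * ‖g q' l + g q l‖ := hBβ _ _
        _ ≤ β * (K * cd / (4 * κ)) * (2 * Dmax / (4 * κ)) := by gcongr
        _ = β * K * cd * Dmax / (8 * κ ^ 2) := by rw [mul_assoc, L1]; ring
    calc κ * |∑ l, (B (g q' l) (g q' l) - B (g q l) (g q l))| ≤ κ * ∑ l, |B (g q' l) (g q' l) - B (g q l) (g q l)| :=
          mul_le_mul_of_nonneg_left (Finset.abs_sum_le_sum_abs _ _) hκ.le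
      _ ≤ κ * ∑ _l : L, β * K * cd * Dmax / (8 * κ ^ 2) :=
          mul_le_mul_of_nonneg_left (Finset.sum_le_sum fun l _ => hge l) hκ.le
      _ = Fintype.card L * (β * K * cd * Dmax / (8 * κ)) := by
          rw [Finset.sum_const, Finset.card_univ, nsmul_eq_mul]
          field_simp
  -- assemble
  calc |(1 / 2) * ∑ l, B (p₁ l) (D q l - D q' l) + (S q' - S q - ∑ l, B (D q l) (p₁ l)) +
          κ * ∑ l, (B (g q' l) (g q' l) - B (g q l) (g q l))|
      ≤ |(1 / 2) * ∑ l, B (p₁ l) (D q l - D q' l)| + |S q' - S q - ∑ l, B (D q l) (p₁ l)| +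
          |κ * ∑ l, (B (g q' l) (g q' l) - B (g q l) (g q l))| := abs_add_three _ _ _
    _ ≤ (1 / 2) * (β * K * cd * ∑ l, ‖p₁ l‖) + (1 / 2) * (β * K * cd * ∑ l, ‖p₁ l‖) +
          Fintype.card L * (β * K * cd * Dmax / (8 * κ)) := add_le_add (add_le_add h1 (h2.trans_eq h2')) h3
    _ = β * K * cd * (∑ l, ‖p₁ l‖ + Fintype.card L * Dmax / (8 * κ)) := by ring

end Step

/-! ## §4 The whole trajectory: `n` steps, momentum growth, and the energy error of the engine's `n`-step proposal -/

section Trajectory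

variable (B : E →ₗ[ℝ] E →ₗ[ℝ] ℝ) [Fintype L]

/-- The consistent half kick is bounded by `D_max/(4κ)` in the sup norm. -/
theorem norm_sunHalfKick_le (κ : ℝ) (hκ : 0 < κ) (D g : (L → Matrix.specialUnitaryGroup n ℂ) → L → E)
    (hg : ∀ W l, g W l = -(1 / (4 * κ)) • D W l) {Dmax : ℝ} (hD0 : 0 ≤ Dmax)
    (hDb : ∀ (W : L → Matrix.specialUnitaryGroup n ℂ) (l : L), ‖D W l‖ ≤ Dmax)
    (W : L → Matrix.specialUnitaryGroup n ℂ) : ‖g W‖ ≤ Dmax / (4 * κ) :=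
  (pi_norm_le_iff_of_nonneg (by positivity)).2 fun l => norm_sunHalfKick_apply_le κ hκ D g hg hDb W l

/-- **Momentum growth along the trajectory**: after `k` steps the sup norm of the momentum has grown by at
most `2k·D_max/(4κ)` and `Σ_l ‖p_l‖` by at most `2k·|L|·D_max/(4κ)`. -/
theorem sunLeapfrogStep_iterate_snd_le (ε κ : ℝ) (hκ : 0 < κ) (D g : (L → Matrix.specialUnitaryGroup n ℂ) → L → E)
    (hg : ∀ W l, g W l = -(1 / (4 * κ)) • D W l) {Dmax : ℝ} (hD0 : 0 ≤ Dmax)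
    (hDb : ∀ (W : L → Matrix.specialUnitaryGroup n ℂ) (l : L), ‖D W l‖ ≤ Dmax)
    (q : L → Matrix.specialUnitaryGroup n ℂ) (p : L → E) (k : ℕ) :
    ‖((⇑(palindromicWord [kick g] (drift (mulDrift (sunExpDrift ι hι ε)))))^[k] (q, p)).2‖ ≤ ‖p‖ + 2 * k * (Dmax / (4 * κ)) ∧
      ∑ l, ‖((⇑(palindromicWord [kick g] (drift (mulDrift (sunExpDrift ι hι ε)))))^[k] (q, p)).2 l‖ ≤
        ∑ l, ‖p l‖ + 2 * k * (Fintype.card L * (Dmax / (4 * κ))) := by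
  have hgn := norm_sunHalfKick_le κ hκ D g hg hD0 hDb
  have hge := norm_sunHalfKick_apply_le κ hκ D g hg hDb
  induction k with
  | zero => simp
  | succ k ih =>
    rw [Function.iterate_succ_apply']
    set z := (⇑(palindromicWord [kick g] (drift (mulDrift (sunExpDrift ι hι ε)))))^[k] (q, p) with hz
    obtain ⟨ih1, ih2⟩ := ih
    have hstep := sunLeapfrogStep_apply ι hι g ε z.1 z.2
    rw [Prod.mk.eta] at hstep
    rw [hstep]
    constructor
    · calc ‖z.2 + g z.1 + g (sunExpDrift ι hι ε (z.2 + g z.1) * z.1)‖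
          ≤ ‖z.2‖ + ‖g z.1‖ + ‖g (sunExpDrift ι hι ε (z.2 + g z.1) * z.1)‖ :=
            (norm_add_le _ _).trans (add_le_add (norm_add_le _ _) le_rfl)
        _ ≤ (‖p‖ + 2 * k * (Dmax / (4 * κ))) + Dmax / (4 * κ) + Dmax / (4 * κ) := add_le_add (add_le_add ih1 (hgn _)) (hgn _)
        _ = ‖p‖ + 2 * ((k + 1 : ℕ) : ℝ) * (Dmax / (4 * κ)) := by push_cast; ring
    · calc ∑ l, ‖(z.2 + g z.1 + g (sunExpDrift ι hι ε (z.2 + g z.1) * z.1)) l‖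
          ≤ ∑ l, (‖z.2 l‖ + Dmax / (4 * κ) + Dmax / (4 * κ)) := by
            refine Finset.sum_le_sum fun l _ => ?_
            rw [Pi.add_apply, Pi.add_apply]
            exact (norm_add_le _ _).trans (add_le_add ((norm_add_le _ _).trans (add_le_add le_rfl (hge _ l))) (hge _ l))
        _ = ∑ l, ‖z.2 l‖ + 2 * (Fintype.card L * (Dmax / (4 * κ))) := by
            rw [Finset.sum_add_distrib, Finset.sum_add_distrib, Finset.sum_const, Finset.card_univ, nsmul_eq_mul]; ring
        _ ≤ ∑ l, ‖p l‖ + 2 * ((k + 1 : ℕ) : ℝ) * (Fintype.card L * (Dmax / (4 * κ))) := by push_cast; linarith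

/-- **THE ENERGY ERROR OF THE `n`-STEP TRAJECTORY**: for every `k ≤ N`,
`|H(wᵏ(q,p)) − H(q,p)| ≤ k · βK·N²C_ι|ε|·(‖p‖ + (2N+1)·D_max/(4κ))·(Σ_l‖p_l‖ + (2N+1)·|L|·D_max/(4κ) + |L|·D_max/(8κ))`
— linear in the number of steps, second order in the step size once `K, D_max = O(ε)`. -/
theorem abs_sunLeapfrogN_energy_error_le {Cι : ℝ} (hC0 : 0 ≤ Cι) (hCι : ∀ x : E, ‖ι x‖ ≤ Cι * ‖x‖)
    (S : (L → Matrix.specialUnitaryGroup n ℂ) → ℝ) (ε κ : ℝ) (hκ : 0 < κ)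
    (hd : ∀ W : L → Matrix.specialUnitaryGroup n ℂ, DifferentiableAt ℝ (fun a : L → E => S (sunExpDrift ι hι ε a * W)) 0)
    (hBs : ∀ x y : E, B x y = B y x) {β : ℝ} (hβ0 : 0 ≤ β) (hBβ : ∀ x y : E, |B x y| ≤ β * ‖x‖ * ‖y‖)
    (D g : (L → Matrix.specialUnitaryGroup n ℂ) → L → E)
    (hD : ∀ (W : L → Matrix.specialUnitaryGroup n ℂ) (δ : L → E),
      fderiv ℝ (fun a : L → E => S (sunExpDrift ι hι ε a * W)) 0 δ = ∑ l, B (D W l) (δ l))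
    {Dmax K : ℝ} (hD0 : 0 ≤ Dmax) (hK0 : 0 ≤ K)
    (hDb : ∀ (W : L → Matrix.specialUnitaryGroup n ℂ) (l : L), ‖D W l‖ ≤ Dmax)
    (hDK : ∀ W W' : L → Matrix.specialUnitaryGroup n ℂ, ‖D W - D W'‖ ≤ K * ‖coeConfig W - coeConfig W'‖)
    (hg : ∀ W l, g W l = -(1 / (4 * κ)) • D W l)
    (q : L → Matrix.specialUnitaryGroup n ℂ) (p : L → E) (N : ℕ) :
    ∀ k ≤ N, |(S ((⇑(palindromicWord [kick g] (drift (mulDrift (sunExpDrift ι hι ε)))))^[k] (q, p)).1 +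
        κ * ∑ l, B (((⇑(palindromicWord [kick g] (drift (mulDrift (sunExpDrift ι hι ε)))))^[k] (q, p)).2 l)
          (((⇑(palindromicWord [kick g] (drift (mulDrift (sunExpDrift ι hι ε)))))^[k] (q, p)).2 l)) -
        (S q + κ * ∑ l, B (p l) (p l))| ≤
      k * (β * K * ((Fintype.card n : ℝ) ^ 2 * Cι * |ε| * (‖p‖ + (2 * N + 1) * (Dmax / (4 * κ)))) *
        ((∑ l, ‖p l‖ + (2 * N + 1) * (Fintype.card L * (Dmax / (4 * κ)))) + Fintype.card L * Dmax / (8 * κ))) := by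
  have hgn := norm_sunHalfKick_le κ hκ D g hg hD0 hDb
  have hge := norm_sunHalfKick_apply_le κ hκ D g hg hDb
  set Bd := β * K * ((Fintype.card n : ℝ) ^ 2 * Cι * |ε| * (‖p‖ + (2 * N + 1) * (Dmax / (4 * κ)))) *
        ((∑ l, ‖p l‖ + (2 * N + 1) * (Fintype.card L * (Dmax / (4 * κ)))) + Fintype.card L * Dmax / (8 * κ)) with hBd
  intro k
  induction k with
  | zero => intro _; simp
  | succ k ih =>
    intro hk
    have hk' : k ≤ N := Nat.le_of_succ_le hk
    have hkN : (k : ℝ) + 1 ≤ N := by exact_mod_cast hk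
    specialize ih hk'
    rw [Function.iterate_succ_apply']
    set z := (⇑(palindromicWord [kick g] (drift (mulDrift (sunExpDrift ι hι ε)))))^[k] (q, p) with hz
    obtain ⟨hz1, hz2⟩ := sunLeapfrogStep_iterate_snd_le ι hι ε κ hκ D g hg hD0 hDb q p k
    rw [← hz] at hz1 hz2
    -- one more step from z
    have hstep := abs_sunLeapfrog_energy_error_le ι hι B hC0 hCι S ε κ hκ hd hBs hβ0 hBβ D g hD hK0 hDb hDK hg z.1 z.2
    have happ := sunLeapfrogStep_apply ι hι g ε z.1 z.2
    rw [Prod.mk.eta] at happ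
    rw [happ]
    simp only
    -- the momentum after the first half kick, and its norms
    have hn1 : ‖z.2 + g z.1‖ ≤ ‖p‖ + (2 * N + 1) * (Dmax / (4 * κ)) := by
      calc ‖z.2 + g z.1‖ ≤ ‖z.2‖ + ‖g z.1‖ := norm_add_le _ _
        _ ≤ (‖p‖ + 2 * k * (Dmax / (4 * κ))) + Dmax / (4 * κ) := add_le_add hz1 (hgn _)
        _ ≤ ‖p‖ + (2 * N + 1) * (Dmax / (4 * κ)) := by nlinarith [div_nonneg hD0 (by positivity : (0:ℝ) ≤ 4 * κ)]
    have hs1 : ∑ l, ‖(z.2 + g z.1) l‖ ≤ ∑ l, ‖p l‖ + (2 * N + 1) * (Fintype.card L * (Dmax / (4 * κ))) := by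
      calc ∑ l, ‖(z.2 + g z.1) l‖ ≤ ∑ l, (‖z.2 l‖ + Dmax / (4 * κ)) := by
            refine Finset.sum_le_sum fun l _ => ?_
            rw [Pi.add_apply]
            exact (norm_add_le _ _).trans (add_le_add le_rfl (hge _ l))
        _ = ∑ l, ‖z.2 l‖ + Fintype.card L * (Dmax / (4 * κ)) := by
            rw [Finset.sum_add_distrib, Finset.sum_const, Finset.card_univ, nsmul_eq_mul]
        _ ≤ ∑ l, ‖p l‖ + (2 * N + 1) * (Fintype.card L * (Dmax / (4 * κ))) := by
            nlinarith [hz2, mul_nonneg (Nat.cast_nonneg (Fintype.card L)) (div_nonneg hD0 (by positivity : (0:ℝ) ≤ 4 * κ))]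
    have hstep' : |(S (sunExpDrift ι hι ε (z.2 + g z.1) * z.1) +
          κ * ∑ l, B ((z.2 + g z.1 + g (sunExpDrift ι hι ε (z.2 + g z.1) * z.1)) l)
            ((z.2 + g z.1 + g (sunExpDrift ι hι ε (z.2 + g z.1) * z.1)) l)) -
        (S z.1 + κ * ∑ l, B (z.2 l) (z.2 l))| ≤ Bd := by
      refine hstep.trans ?_
      rw [hBd]
      have hc0 : 0 ≤ Fintype.card L * Dmax / (8 * κ) := by positivity
      have hsum0 : 0 ≤ ∑ l, ‖(z.2 + g z.1) l‖ := Finset.sum_nonneg fun l _ => norm_nonneg _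
      gcongr
    -- telescope
    calc |(S (sunExpDrift ι hι ε (z.2 + g z.1) * z.1) +
            κ * ∑ l, B ((z.2 + g z.1 + g (sunExpDrift ι hι ε (z.2 + g z.1) * z.1)) l)
              ((z.2 + g z.1 + g (sunExpDrift ι hι ε (z.2 + g z.1) * z.1)) l)) -
          (S q + κ * ∑ l, B (p l) (p l))|
        ≤ |(S (sunExpDrift ι hι ε (z.2 + g z.1) * z.1) +
              κ * ∑ l, B ((z.2 + g z.1 + g (sunExpDrift ι hι ε (z.2 + g z.1) * z.1)) l)
                ((z.2 + g z.1 + g (sunExpDrift ι hι ε (z.2 + g z.1) * z.1)) l)) -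
            (S z.1 + κ * ∑ l, B (z.2 l) (z.2 l))| +
          |(S z.1 + κ * ∑ l, B (z.2 l) (z.2 l)) - (S q + κ * ∑ l, B (p l) (p l))| := abs_sub_le _ _ _
      _ ≤ Bd + k * Bd := add_le_add hstep' ih
      _ = ((k + 1 : ℕ) : ℝ) * Bd := by push_cast; ring

/-- **THE ENERGY ERROR OF THE ENGINE'S `n`-STEP `SU(N)` PROPOSAL** `sunLeapfrogProposalN ι hι ε g n = flip ∘ (kick–drift–kick)ⁿ`
with the consistent half kick — the quantity in the Metropolis test of `sunLeapfrogHMCN` with kinetic term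
`κΣ_l B(p_l,p_l)`:
`|H(Ψ_n(q,p)) − H(q,p)| ≤ n · βK·N²C_ι|ε|·(‖p‖ + (2n+1)·D_max/(4κ))·(Σ_l‖p_l‖ + (2n+1)·|L|·D_max/(4κ) + |L|·D_max/(8κ))`.
Hence the acceptance probability of the proposal is at least `exp(−that)` pointwise; with `K, D_max = O(ε)`
the bound is `O(nε²) = O(τε)` at fixed trajectory length `τ = nε`. -/
theorem abs_sunLeapfrogProposalN_energy_error_le {Cι : ℝ} (hC0 : 0 ≤ Cι) (hCι : ∀ x : E, ‖ι x‖ ≤ Cι * ‖x‖)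
    (S : (L → Matrix.specialUnitaryGroup n ℂ) → ℝ) (ε κ : ℝ) (hκ : 0 < κ)
    (hd : ∀ W : L → Matrix.specialUnitaryGroup n ℂ, DifferentiableAt ℝ (fun a : L → E => S (sunExpDrift ι hι ε a * W)) 0)
    (hBs : ∀ x y : E, B x y = B y x) {β : ℝ} (hβ0 : 0 ≤ β) (hBβ : ∀ x y : E, |B x y| ≤ β * ‖x‖ * ‖y‖)
    (D g : (L → Matrix.specialUnitaryGroup n ℂ) → L → E)
    (hD : ∀ (W : L → Matrix.specialUnitaryGroup n ℂ) (δ : L → E),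
      fderiv ℝ (fun a : L → E => S (sunExpDrift ι hι ε a * W)) 0 δ = ∑ l, B (D W l) (δ l))
    {Dmax K : ℝ} (hD0 : 0 ≤ Dmax) (hK0 : 0 ≤ K)
    (hDb : ∀ (W : L → Matrix.specialUnitaryGroup n ℂ) (l : L), ‖D W l‖ ≤ Dmax)
    (hDK : ∀ W W' : L → Matrix.specialUnitaryGroup n ℂ, ‖D W - D W'‖ ≤ K * ‖coeConfig W - coeConfig W'‖)
    (hg : ∀ W l, g W l = -(1 / (4 * κ)) • D W l)
    (q : L → Matrix.specialUnitaryGroup n ℂ) (p : L → E) (N : ℕ) :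
    |(S (sunLeapfrogProposalN ι hι ε g N (q, p)).1 +
        κ * ∑ l, B ((sunLeapfrogProposalN ι hι ε g N (q, p)).2 l) ((sunLeapfrogProposalN ι hι ε g N (q, p)).2 l)) -
        (S q + κ * ∑ l, B (p l) (p l))| ≤
      N * (β * K * ((Fintype.card n : ℝ) ^ 2 * Cι * |ε| * (‖p‖ + (2 * N + 1) * (Dmax / (4 * κ)))) *
        ((∑ l, ‖p l‖ + (2 * N + 1) * (Fintype.card L * (Dmax / (4 * κ)))) + Fintype.card L * Dmax / (8 * κ))) := by
  have h := abs_sunLeapfrogN_energy_error_le ι hι B hC0 hCι S ε κ hκ hd hBs hβ0 hBβ D g hD hD0 hK0 hDb hDK hg q p N N le_rfl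
  rw [sunLeapfrogProposalN, Equiv.Perm.coe_mul, Function.comp_apply, flip_apply, Equiv.Perm.coe_pow]
  simp only [Pi.neg_apply, map_neg, LinearMap.neg_apply, neg_neg]
  exact h

end Trajectory

end Summit.Ventures.LatticeQCDFlow.Exactness
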